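import Summits.HodgeConjecture.HodgeConjecture.Cruxes.BlochSeedDiscOne.BnCCertCover4

/-!
# BnCCertCover5 — module 5 of the «v1 + L1(.5) + ℤ + S + O» checker (dual g12, 2026-08-30): image 3's representative P-pass, in 8 chunks of 88 columns

Module 4 (`BnCCertCover4.lean` 832c00c23d18) proves the (U2) end theorem `Replay4273.halfRegion4273_m3bPresent_empty` modulo the two ordered passes
`PassOK lf3 Side.N ∕ Side.P` of the image-3 leaf.  This module discharges the P-pass: `ordColsR … Side.P` has ≤ 704 representative columns
(`img3_repsP_le`), checked here in 8 `decide +kernel` chunks of 88 columns (≈ 0.75 s per column measured) and assembled by the §39 chunk chain and §41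
`checkPtO_of_allR` into `Replay4273.pass3P : PassOK lf3 Side.P`.  The N-pass (≤ 1 356 columns) is modules 6–7 (chunks, each importing only module 4)
and module 8 (assembly + the hypothesis-free half-region theorem).  Nothing here is proved toward `FloorFree 6 199 8` ∕ 18881 ∕ H2 ∕ HC: chunk lemmas of one image's ordered pass are evidence that a MODEL-grade certificate replays, not a floor statement.
-/

set_option autoImplicit false

namespace Summit.HodgeConjecture.HodgeConjecture.Cruxes.BlochSeedDiscOne.BnCCertCover

open Summit.HodgeConjecture.HodgeConjecture.Cruxes.BlochSeedDiscOne.DepthBoundA4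
open Summit.HodgeConjecture.HodgeConjecture.Cruxes.BlochSeedDiscOne.RingFiveEmpty
open Summit.HodgeConjecture.HodgeConjecture.Cruxes.BlochSeedDiscOne.BnCCert

namespace Replay4273

/-- image 3's pointwise predicate on side `P` and its representative column list (§41 `ordColsR`) -/
def QP : STuple → Bool :=
  ptOKO (ents C5.vars lf3.n.m.core.base) γ0 lf3.n.m.core.base.L lf3.n.m.core.base.ρ lf3.n.m.core.bans (lf3.n.m.presEff C5.B) lf3.n.m.core.kbans
    lf3.n.m.core.kpres lf3.n.m.core.ephi lf3.orows (lf3.X C5.B) (obanHit lf3.obans) Side.P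
def colsP : List STuple := ordColsR C5.h (allBounds C5.vars lf3.n.m.core.base) Side.P

theorem lenP : colsP.length ≤ 704 := le_trans img3_repsP_le (by decide)

theorem P_c0 : (((colsP).drop 0).take 88).all QP = true := by
  decide +kernel
theorem P_c1 : (((colsP).drop (0 + 88)).take 88).all QP = true := by
  decide +kernel
theorem P_c2 : (((colsP).drop (0 + 88 + 88)).take 88).all QP = true := by
  decide +kernel
theorem P_c3 : (((colsP).drop (0 + 88 + 88 + 88)).take 88).all QP = true := by
  decide +kernel
theorem P_c4 : (((colsP).drop (0 + 88 + 88 + 88 + 88)).take 88).all QP = true := by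
  decide +kernel
theorem P_c5 : (((colsP).drop (0 + 88 + 88 + 88 + 88 + 88)).take 88).all QP = true := by
  decide +kernel
theorem P_c6 : (((colsP).drop (0 + 88 + 88 + 88 + 88 + 88 + 88)).take 88).all QP = true := by
  decide +kernel
theorem P_c7 : (((colsP).drop (0 + 88 + 88 + 88 + 88 + 88 + 88 + 88)).take 88).all QP = true := by
  decide +kernel

theorem allP : colsP.all QP = true :=
  all_of_drop_zero _ _ (all_drop_of_chunk _ _ _ _ P_c0 (all_drop_of_chunk _ _ _ _ P_c1 (all_drop_of_chunk _ _ _ _ P_c2 (all_drop_of_chunk _ _ _ _ P_c3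
    (all_drop_of_chunk _ _ _ _ P_c4 (all_drop_of_chunk _ _ _ _ P_c5 (all_drop_of_chunk _ _ _ _ P_c6 (all_drop_of_chunk _ _ _ _ P_c7
    (all_drop_of_length_le _ _ _ lenP)))))))))

/-- **image 3's ordered P-pass** -/
theorem pass3P : PassOK lf3 Side.P := checkPtO_of_allR (LeafO.stabInv3_of_OK C5 lf3 γ0 Side.P img3_stab3OK) allP

end Replay4273

end Summit.HodgeConjecture.HodgeConjecture.Cruxes.BlochSeedDiscOne.BnCCertCover
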